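import Literature.AnabelianGeometry.SemiGraphs.ArithTemperedGroupOfLevels
import HarnessLib

/-!
# [SemiAnbd] Prop 5.2 (iv) / Thm 5.4 producer T54-B: the TEMPERED TOPOLOGY of the outer model
# `π₁^temp(𝒢) ⋊^out Π_A` as a NAMED TERM (row «T54·E-top» of the T54 binder board)

Mochizuki, *Semi-graphs of anabelioids*, Publ. RIMS **42** (2006), §0 p. 5 (`G ⋊^out J`), §3 Def 3.1 (i)
p. 33 (tempered groups), §5 Def 5.1 (i) p. 62, Prop 5.2 (iii)/(iv) p. 64 ("natural exact sequences
`1 → Π^temp_𝒢 → Π^temp_𝔊 → Π_A → 1`"), Thm 5.4 (i) p. 66 [cite: MochizukiSemiAnbd2006, Prop 5.2 (iv), p. 64].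

abc-iut cell, producer row T54-B (`HOME/plan/GAP-LEDGER.md` G-w4d053-1), sub-row «T54·E-top» (abc-iut-L3-lead
rulings α35/α36 (2)/α37 (2), 2026-08-26; seat abc-iut-w6-d070; shape = abc-iut-w4-d082's answer 07:04:11Z (iii)).

WHAT THIS FILE DOES (zero new mathematics; DEFINITION-by-choice + its specification, all proofs by name).
The capstone of T54-B (abc-iut-w4-d029, `ArithThm54iCapstoneOuterAction.lean`,
`arithMaximalCompactStatementI_outerAction_piPresentation`) is stated over INSTANCE BINDERS
`[TopologicalSpace (outerSemidirectProduct ρ')] [IsTopologicalGroup (outerSemidirectProduct ρ')]` and the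
binder `hKopen : ∀ n, IsOpen (ker (arithAct hP (ker projAut n) (hKst n)))`.  The tree so far held the
topology of `Π^temp_𝔊 := π₁^temp(𝒢) ⋊^out Π_A` only behind an existential
(abc-iut-L3-d2 `TemperedExtension.exists_isTempered_topology_of_kernelSeq` /
`ProfiniteSemiGraph.exists_topology_arithTemperedGroup_of_kernelSeq`; abc-iut-w4-d053's packaging
`exists_arithTemperedGroup_of_presentation` over the arithmetic LEVEL KERNELS `levelKer (N n)` of
abc-iut-L3-d4).  Here the SAME topology is made a named term and its properties named lemmas:

* `ProfiniteSemiGraph.arithLevelTopology …` — `TopologicalSpace (outerSemidirectProduct ρ)`, by `Exists.choose`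
  from the level-kernel instantiation of L3-d2's theorem (the tempered topology generated by the
  `levelKer (N n) ⊓ aug⁻¹ U`, `U ⊴ Π_A` open normal);
* `arithLevelTopology_isTopologicalGroup` (a term, NOT a global instance), `arithLevelTopology_nhds_hasBasis`,
  `isOpen_levelKer`, `isTempered_arithLevelTopology`, `isEmbedding_toOuterSemidirectProduct`,
  `continuous_toOuterSemidirectProduct`, `isClosed_range_toOuterSemidirectProduct`,
  `continuous_outerSemidirectProductSnd`, `isOpenMap_outerSemidirectProductSnd`;
* the capstone binder **`hKopen`**: `isOpen_ker_arithAct` — the kernel of the action on the level-`N n`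
  coset semi-graph is open (it contains the open `levelKer (N n)`), and more generally
  `isOpen_ker_arithAct_of_le` for every `Φ`-stable level above some `N n` (e.g. the FINITE levels
  `ker piLevelAut n ⊇ ker projAut n` — the `hopen` input of abc-iut-w4-d085's (E) `hcof_of_faithful_levels`);
* `isOpen_comap_outerSemidirectProductSnd` — preimages of open sets of `Π_A` are open.

RESIDUAL INPUTS (binders, exactly those of `exists_arithTemperedGroup_of_presentation`): the Prop 3.6
hypotheses `h36`, `Π_A` tempered (`hA`), a subgroup presentation `P` compatible with the outer model
(`hP : IsArithCompatible`), one compact vertex group (`hcpt`), an antitone cofinal sequence of open normal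
`Φ`-stable levels `N n` (`hNn`, `hNst`, `hNanti`, `hNopen`, `hNcof`) and the ONE continuity binder
`hK1' : ∀ n, IsOpen (aug (levelKer (N n)))` (Def 5.1 (i)(c) congruence-continuity; reduced by abc-iut-L3-d2 /
abc-iut-w4-d082 to `hρcong`, GAP-LEDGER G-L3d2g2-1 at the finite levels).  Nothing is asserted about them.
No `instance` is declared (consumers write `letI := arithLevelTopology …` or pass `(inst := …)`).  Nothing here
refers to the IUT corpus beyond the producer row it serves; no side is taken on [IUTchIII] Cor 3.12;
typed ≠ proved for the residual inputs.
-/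

namespace Literature.AnabelianGeometry.SemiGraphs

namespace ProfiniteSemiGraph

open CategoryTheory Topology Filter
open Literature.AnabelianGeometry.EtaleTheta

universe u

variable {𝒢 : ProfiniteSemiGraph.{u}} (c : TemperedPiChart 𝒢)
  {PA : Type u} [Group PA] [TopologicalSpace PA] [IsTopologicalGroup PA]
  (ρ : PA →* TopOut c.G) (baseAct : PA →* Aut 𝒢.graph)

section LevelTopology

variable [FirstCountableTopology c.G]
  (h36 : 𝒢.Prop36Hypotheses) (hA : IsTempered PA)
  (P : SemiGraph.SubgroupPresentation 𝒢.graph c.G)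
  (hP : P.IsArithCompatible
    (((contMulAut c.G).subtype.comp (MonoidHom.fst (contMulAut c.G) PA)).comp
      (outerSemidirectProduct ρ).subtype)
    (baseAct.comp (outerSemidirectProductSnd ρ)))
  (w₀ : 𝒢.graph.Vertex) (hcpt : IsCompact (P.H w₀ : Set c.G))
  (N : ℕ → Subgroup c.G) (hNn : ∀ n, (N n).Normal)
  (hNst : ∀ (n : ℕ) (e : outerSemidirectProduct ρ) (x : c.G), x ∈ N n →
    (((contMulAut c.G).subtype.comp (MonoidHom.fst (contMulAut c.G) PA)).comp
      (outerSemidirectProduct ρ).subtype) e x ∈ N n)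
  (hNanti : Antitone N) (hNopen : ∀ n, IsOpen (N n : Set c.G))
  (hNcof : ∀ U ∈ 𝓝 (1 : c.G), ∃ n, (N n : Set c.G) ⊆ U)
  (hK1' : ∀ n, IsOpen (((P.levelKer hP (N n) (hNst n)).map (outerSemidirectProductSnd ρ) :
    Subgroup PA) : Set PA))

include h36 hA hcpt hNn hNanti hNopen hNcof hK1'

/-- **The tempered topology of `π₁^temp(𝒢) ⋊^out Π_A` generated by the arithmetic level kernels — existence
with its full specification ON THE CARRIER** ([SemiAnbd] Prop 5.2 (iv) p. 64; abc-iut-L3-d2's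
`TemperedExtension.exists_isTempered_topology_of_kernelSeq` at the level kernels `levelKer (N n)` of
abc-iut-L3-d4, the four level facts exactly as in abc-iut-w4-d053's `exists_arithTemperedGroup_of_presentation`):
a group topology with basis of neighbourhoods of `1` the `levelKer (N n) ⊓ aug⁻¹U` (`U ⊴ Π_A` open normal),
every `levelKer (N n)` open, TEMPERED, `ι` a closed embedding, `aug` continuous and open.
[cite: MochizukiSemiAnbd2006, Prop 5.2 (iv), p. 64] -/
theorem exists_arithLevelTopology :
    ∃ τ : TopologicalSpace (outerSemidirectProduct ρ),
      @IsTopologicalGroup (outerSemidirectProduct ρ) τ _ ∧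
      (@nhds _ τ 1).HasBasis (fun _ : ℕ × OpenNormalSubgroup PA => True)
        (fun nU => ((P.levelKer hP (N nU.1) (hNst nU.1) ⊓
          nU.2.toSubgroup.comap (outerSemidirectProductSnd ρ) :
            Subgroup (outerSemidirectProduct ρ)) : Set (outerSemidirectProduct ρ))) ∧
      (∀ n, @IsOpen _ τ (P.levelKer hP (N n) (hNst n))) ∧
      @IsTempered (outerSemidirectProduct ρ) _ τ ∧
      @IsEmbedding _ _ _ τ (toOuterSemidirectProduct ρ) ∧
      @IsClosed _ τ (Set.range (toOuterSemidirectProduct ρ)) ∧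
      @Continuous _ _ τ _ (outerSemidirectProductSnd ρ) ∧
      @IsOpenMap _ _ τ _ (outerSemidirectProductSnd ρ) := by
  -- exactness of `1 → π₁^temp(𝒢) → E → Π_A → 1` (temp-slimness of `π₁^temp(𝒢)`)
  obtain ⟨hinj, hex, hsurj⟩ := outerAction_exact c ρ h36
  -- the inner action `ι` sits inside `Φ` as conjugation and inside `σ` trivially
  have hιΦ : ∀ g : c.G,
      (((contMulAut c.G).subtype.comp (MonoidHom.fst (contMulAut c.G) PA)).comp
        (outerSemidirectProduct ρ).subtype) (toOuterSemidirectProduct ρ g) = MulAut.conj g :=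
    fun g => rfl
  have hισ : ∀ g : c.G,
      (baseAct.comp (outerSemidirectProductSnd ρ)) (toOuterSemidirectProduct ρ g) = 1 := fun g => by
    simp
  -- `π₁^temp(𝒢)` is Hausdorff (open normal subgroups separate points) and centre-free (temp-slim)
  haveI : T2Space c.G := by
    refine IsTopologicalGroup.t2Space_of_one_sep fun x hx => ?_
    obtain ⟨M, hM⟩ := c.isTempered.separated x hx
    exact ⟨M, M.toOpenSubgroup.mem_nhds_one, hM⟩
  have hZ : Subgroup.center c.G = ⊥ := center_eq_bot_of_isSlimGroup (temperedPiSlim_holds 𝒢 h36 c)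
  refine TemperedExtension.exists_isTempered_topology_of_kernelSeq (toOuterSemidirectProduct ρ)
    (outerSemidirectProductSnd ρ) (fun n => P.levelKer hP (N n) (hNst n)) c.isTempered hA hinj hex hsurj
    (fun m n hmn => ?_) (fun n => ?_) (fun n => ?_) hK1' ?_
  · exact P.levelKer_mono hP (hNst n) (hNst m) (hNanti hmn)
  · exact P.levelKer_normal hP (N n) (hNst n)
  · haveI := hNn n
    exact Subgroup.isOpen_mono
      (P.le_comap_levelKer hP (N n) (hNst n) (toOuterSemidirectProduct ρ) hιΦ hισ) (hNopen n)
  · exact P.comap_levelKer_cofinal hP w₀ hcpt hZ N hNn hNst hNanti hNopen hNcof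
      (toOuterSemidirectProduct ρ) hιΦ hισ

/-- **`arithLevelTopology` — THE tempered topology of the outer model `π₁^temp(𝒢) ⋊^out Π_A` as a named
TERM** (the topology of `exists_arithLevelTopology`, chosen once; consumers `letI := arithLevelTopology …`).  No global
instance is declared. [cite: MochizukiSemiAnbd2006, Prop 5.2 (iv), p. 64] -/
@[reducible] noncomputable def arithLevelTopology : TopologicalSpace (outerSemidirectProduct ρ) :=
  (exists_arithLevelTopology c ρ baseAct h36 hA P hP w₀ hcpt N hNn hNst hNanti hNopen hNcof hK1').choose

/-- `π₁^temp(𝒢) ⋊^out Π_A` with `arithLevelTopology` is a topological group (the `IsTopologicalGroup` instance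
binder of the T54-B capstone, as a term). [cite: MochizukiSemiAnbd2006, Prop 5.2 (iv), p. 64] -/
theorem arithLevelTopology_isTopologicalGroup :
    @IsTopologicalGroup (outerSemidirectProduct ρ)
      (arithLevelTopology c ρ baseAct h36 hA P hP w₀ hcpt N hNn hNst hNanti hNopen hNcof hK1') _ :=
  (exists_arithLevelTopology c ρ baseAct h36 hA P hP w₀ hcpt N hNn hNst hNanti hNopen hNcof hK1').choose_spec.1

/-- The neighbourhoods of `1` for `arithLevelTopology` have the basis `levelKer (N n) ⊓ aug⁻¹U`, `n : ℕ`,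
`U ⊴ Π_A` open normal. [cite: MochizukiSemiAnbd2006, Prop 5.2 (iv), p. 64] -/
theorem arithLevelTopology_nhds_hasBasis :
    (@nhds _ (arithLevelTopology c ρ baseAct h36 hA P hP w₀ hcpt N hNn hNst hNanti hNopen hNcof hK1') 1).HasBasis
      (fun _ : ℕ × OpenNormalSubgroup PA => True)
      (fun nU => ((P.levelKer hP (N nU.1) (hNst nU.1) ⊓
        nU.2.toSubgroup.comap (outerSemidirectProductSnd ρ) :
          Subgroup (outerSemidirectProduct ρ)) : Set (outerSemidirectProduct ρ))) :=
  (exists_arithLevelTopology c ρ baseAct h36 hA P hP w₀ hcpt N hNn hNst hNanti hNopen hNcof hK1').choose_spec.2.1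

/-- Every arithmetic level kernel `levelKer (N n)` is OPEN for `arithLevelTopology`.
[cite: MochizukiSemiAnbd2006, Prop 5.2 (iv), p. 64] -/
theorem isOpen_levelKer (n : ℕ) :
    IsOpen[arithLevelTopology c ρ baseAct h36 hA P hP w₀ hcpt N hNn hNst hNanti hNopen hNcof hK1']
      (P.levelKer hP (N n) (hNst n) : Set (outerSemidirectProduct ρ)) :=
  (exists_arithLevelTopology c ρ baseAct h36 hA P hP w₀ hcpt N hNn hNst hNanti hNopen hNcof hK1').choose_spec.2.2.1
    n

/-- `π₁^temp(𝒢) ⋊^out Π_A` with `arithLevelTopology` is TEMPERED ([SemiAnbd] Def 3.1 (i): "`B^temp(𝔊)` is a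
connected temperoid", Prop 5.2 (iii)). [cite: MochizukiSemiAnbd2006, Prop 5.2 (iv), p. 64] -/
theorem isTempered_arithLevelTopology :
    @IsTempered (outerSemidirectProduct ρ) _
      (arithLevelTopology c ρ baseAct h36 hA P hP w₀ hcpt N hNn hNst hNanti hNopen hNcof hK1') :=
  (exists_arithLevelTopology c ρ baseAct h36 hA P hP w₀ hcpt N hNn hNst hNanti hNopen hNcof
    hK1').choose_spec.2.2.2.1

/-- `π₁^temp(𝒢) ⋊^out Π_A` with `arithLevelTopology` is HAUSDORFF (tempered groups are separated: every
`e ≠ 1` lies outside some open normal subgroup). [cite: MochizukiSemiAnbd2006, Def 3.1 (i), p. 33] -/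
theorem arithLevelTopology_t2Space :
    @T2Space (outerSemidirectProduct ρ)
      (arithLevelTopology c ρ baseAct h36 hA P hP w₀ hcpt N hNn hNst hNanti hNopen hNcof hK1') := by
  letI := arithLevelTopology c ρ baseAct h36 hA P hP w₀ hcpt N hNn hNst hNanti hNopen hNcof hK1'
  haveI := arithLevelTopology_isTopologicalGroup c ρ baseAct h36 hA P hP w₀ hcpt N hNn hNst hNanti hNopen
    hNcof hK1'
  refine IsTopologicalGroup.t2Space_of_one_sep fun x hx => ?_
  obtain ⟨M, hM⟩ := (isTempered_arithLevelTopology c ρ baseAct h36 hA P hP w₀ hcpt N hNn hNst hNanti hNopen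
    hNcof hK1').separated x hx
  exact ⟨M, M.toOpenSubgroup.mem_nhds_one, hM⟩

/-- `ι : π₁^temp(𝒢) → π₁^temp(𝒢) ⋊^out Π_A` is a topological embedding for `arithLevelTopology`.
[cite: MochizukiSemiAnbd2006, Prop 5.2 (iv), p. 64] -/
theorem isEmbedding_toOuterSemidirectProduct :
    @IsEmbedding _ _ _ (arithLevelTopology c ρ baseAct h36 hA P hP w₀ hcpt N hNn hNst hNanti hNopen hNcof hK1')
      (toOuterSemidirectProduct ρ) :=
  (exists_arithLevelTopology c ρ baseAct h36 hA P hP w₀ hcpt N hNn hNst hNanti hNopen hNcof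
    hK1').choose_spec.2.2.2.2.1

/-- `ι : π₁^temp(𝒢) → π₁^temp(𝒢) ⋊^out Π_A` is continuous for `arithLevelTopology`.
[cite: MochizukiSemiAnbd2006, Prop 5.2 (iv), p. 64] -/
theorem continuous_toOuterSemidirectProduct :
    @Continuous _ _ _ (arithLevelTopology c ρ baseAct h36 hA P hP w₀ hcpt N hNn hNst hNanti hNopen hNcof hK1')
      (toOuterSemidirectProduct ρ) :=
  by
  letI := arithLevelTopology c ρ baseAct h36 hA P hP w₀ hcpt N hNn hNst hNanti hNopen hNcof hK1'
  exact (isEmbedding_toOuterSemidirectProduct c ρ baseAct h36 hA P hP w₀ hcpt N hNn hNst hNanti hNopen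
    hNcof hK1').continuous

/-- The image of `ι` (`= ker aug = π₁^temp(𝒢)`) is CLOSED for `arithLevelTopology`.
[cite: MochizukiSemiAnbd2006, Prop 5.2 (iv), p. 64] -/
theorem isClosed_range_toOuterSemidirectProduct :
    IsClosed[arithLevelTopology c ρ baseAct h36 hA P hP w₀ hcpt N hNn hNst hNanti hNopen hNcof hK1']
      (Set.range (toOuterSemidirectProduct ρ)) :=
  (exists_arithLevelTopology c ρ baseAct h36 hA P hP w₀ hcpt N hNn hNst hNanti hNopen hNcof
    hK1').choose_spec.2.2.2.2.2.1

/-- `aug : π₁^temp(𝒢) ⋊^out Π_A → Π_A` is continuous for `arithLevelTopology`.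
[cite: MochizukiSemiAnbd2006, Prop 5.2 (iv), p. 64] -/
theorem continuous_outerSemidirectProductSnd :
    @Continuous _ _ (arithLevelTopology c ρ baseAct h36 hA P hP w₀ hcpt N hNn hNst hNanti hNopen hNcof hK1') _
      (outerSemidirectProductSnd ρ) :=
  (exists_arithLevelTopology c ρ baseAct h36 hA P hP w₀ hcpt N hNn hNst hNanti hNopen hNcof
    hK1').choose_spec.2.2.2.2.2.2.1

/-- `aug : π₁^temp(𝒢) ⋊^out Π_A → Π_A` is an OPEN map for `arithLevelTopology` (the `haug` input of
abc-iut-w4-d085's (E) `hcof_of_faithful_levels`). [cite: MochizukiSemiAnbd2006, Prop 5.2 (iv), p. 64] -/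
theorem isOpenMap_outerSemidirectProductSnd :
    @IsOpenMap _ _ (arithLevelTopology c ρ baseAct h36 hA P hP w₀ hcpt N hNn hNst hNanti hNopen hNcof hK1') _
      (outerSemidirectProductSnd ρ) :=
  (exists_arithLevelTopology c ρ baseAct h36 hA P hP w₀ hcpt N hNn hNst hNanti hNopen hNcof
    hK1').choose_spec.2.2.2.2.2.2.2

/-- Preimages under `aug` of open subsets of `Π_A` are open for `arithLevelTopology`.
[cite: MochizukiSemiAnbd2006, Prop 5.2 (iv), p. 64] -/
theorem isOpen_preimage_outerSemidirectProductSnd {U : Set PA} (hU : IsOpen U) :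
    IsOpen[arithLevelTopology c ρ baseAct h36 hA P hP w₀ hcpt N hNn hNst hNanti hNopen hNcof hK1']
      (outerSemidirectProductSnd ρ ⁻¹' U) :=
  by
  letI := arithLevelTopology c ρ baseAct h36 hA P hP w₀ hcpt N hNn hNst hNanti hNopen hNcof hK1'
  exact (continuous_outerSemidirectProductSnd c ρ baseAct h36 hA P hP w₀ hcpt N hNn hNst hNanti hNopen
    hNcof hK1').isOpen_preimage U hU

/-- **The capstone binder `hKopen`** ([SemiAnbd] Thm 5.4 (i) at `π₁^temp(𝒢) ⋊^out Π_A`, abc-iut-w4-d029's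
`arithMaximalCompactStatementI_outerAction_piPresentation`): for `arithLevelTopology` the kernel of the
arithmetic action on the level-`N n` coset semi-graph is OPEN — it contains the open subgroup
`levelKer (N n) = ker (arithAct (N n)) ⊓ ker σ ⊓ centralMod Φ (N n)`.
[cite: MochizukiSemiAnbd2006, Thm 5.4 (i), p. 66] -/
theorem isOpen_ker_arithAct (n : ℕ) :
    IsOpen[arithLevelTopology c ρ baseAct h36 hA P hP w₀ hcpt N hNn hNst hNanti hNopen hNcof hK1']
      ((P.arithAct hP (N n) (hNst n)).ker : Set (outerSemidirectProduct ρ)) := by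
  letI := arithLevelTopology c ρ baseAct h36 hA P hP w₀ hcpt N hNn hNst hNanti hNopen hNcof hK1'
  haveI := arithLevelTopology_isTopologicalGroup c ρ baseAct h36 hA P hP w₀ hcpt N hNn hNst hNanti hNopen hNcof
    hK1'
  refine Subgroup.isOpen_mono ?_
    (isOpen_levelKer c ρ baseAct h36 hA P hP w₀ hcpt N hNn hNst hNanti hNopen hNcof hK1' n)
  intro e he
  rw [P.mem_levelKer_iff hP (N n) (hNst n)] at he
  exact he.1

/-- **`hKopen` at every coarser level** (e.g. the FINITE levels `ker piLevelAut n ⊇ ker projAut n`, the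
`hopen` input of abc-iut-w4-d085's (E) `hcof_of_faithful_levels`): for a `Φ`-stable level `L ⊇ N n` the
kernel of the arithmetic action on the level-`L` coset semi-graph is open for `arithLevelTopology` (acting
trivially at the finer level implies acting trivially at the coarser one: the transition maps are
equivariant and surjective on representatives). [cite: MochizukiSemiAnbd2006, Thm 5.4 (i), p. 66] -/
theorem isOpen_ker_arithAct_of_le {L : Subgroup c.G}
    (hL : ∀ (e : outerSemidirectProduct ρ) (x : c.G), x ∈ L →
      (((contMulAut c.G).subtype.comp (MonoidHom.fst (contMulAut c.G) PA)).comp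
        (outerSemidirectProduct ρ).subtype) e x ∈ L)
    {n : ℕ} (hNL : N n ≤ L) :
    IsOpen[arithLevelTopology c ρ baseAct h36 hA P hP w₀ hcpt N hNn hNst hNanti hNopen hNcof hK1']
      ((P.arithAct hP L hL).ker : Set (outerSemidirectProduct ρ)) := by
  letI := arithLevelTopology c ρ baseAct h36 hA P hP w₀ hcpt N hNn hNst hNanti hNopen hNcof hK1'
  haveI := arithLevelTopology_isTopologicalGroup c ρ baseAct h36 hA P hP w₀ hcpt N hNn hNst hNanti hNopen hNcof
    hK1'
  refine Subgroup.isOpen_mono ?_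
    (isOpen_ker_arithAct c ρ baseAct h36 hA P hP w₀ hcpt N hNn hNst hNanti hNopen hNcof hK1' n)
  intro e he
  rw [MonoidHom.mem_ker] at he ⊢
  -- trivial at the finer level ⇒ trivial at the coarser level
  ext : 1
  have htr := P.arithAct_trans hP (hNst n) hL hNL e
  rw [he] at htr
  refine P.hom_ext_mk L _ _ (fun w y => ?_) (fun ε y => ?_) (fun b y => ?_)
  · exact (congrArg (fun f : P.cosetGraph (N n) ⟶ P.cosetGraph L => f.vertexMap (P.vMk (N n) w y)) htr).symm
  · exact (congrArg (fun f : P.cosetGraph (N n) ⟶ P.cosetGraph L => f.edgeMap (P.eMk (N n) ε y)) htr).symm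
  · exact (congrArg (fun f : P.cosetGraph (N n) ⟶ P.cosetGraph L => f.branchMap (P.bMk (N n) b y)) htr).symm

end LevelTopology

end ProfiniteSemiGraph

end Literature.AnabelianGeometry.SemiGraphs
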